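import Literature.Analysis.FluidPDE.BiotSavart2DQuasiLipschitz
import Literature.Analysis.FluidPDE.BiotSavart2DContinuity
import Literature.Analysis.ODE.QuasiLipschitzFlow
import HarnessLib

/-!
# Majda–Bertozzi §8.2.2–8.2.3: the particle trajectories of the Biot–Savart velocity of a planar
# vorticity bounded in `L¹ ∩ L^∞` — bounded speed (8.27), quasi-Lipschitz (8.32), unique
# trajectories through every point with Yudovich's Hölder estimates (8.33)–(8.36)

Literature file (topic `Analysis/FluidPDE`), the assembly of

* Lemma 8.1, (8.32) (`BiotSavart2DQuasiLipschitz.lean`): for `|w| ≤ A`, `w ∈ L¹(ℝ²)`,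
  `v = K₂ ∗ w` satisfies `|v(x¹) − v(x²)| ≤ 5(A + ‖w‖₁) d (1 − log d)`, `0 < d = |x¹ − x²| < 1`;
* (8.27) (`BiotSavart2DSymmetry.lean`, `norm_biotSavart2D_le`):
  `|v| ≤ (2π)⁻¹ (A ∫_{|z|<1}|z|⁻¹ dz + ‖w‖₁)`;
* Lemma 8.2 and §8.2.4 "the limit particle trajectory `Xᵗ(·)` is unique"
  (`ODE/QuasiLipschitzFlow.lean`: a bounded, continuous, quasi-Lipschitz field has exactly one
  integral curve through every point, defined for all times, with the estimates (8.33)–(8.36)),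

for a time-dependent planar vorticity `ω : ℝ → (ℝ² → ℝ)` with `|ω(t, ·)| ≤ A`, `‖ω(t, ·)‖₁ ≤ W`
for all `t` (MB (8.21)–(8.22): `|||ω(·,t)||| ≤ |||ω₀|||` along 2D Euler) whose velocity
`v(t, ·) = K₂ ∗ ω(t, ·)` is jointly continuous in `(t, x)` (MB: `v^ε` smooth; for the weak
solution itself this is the content of Prop. 8.2 (i)–(ii), not typed here). With
`L = 5(A + W)` and `M = (2π)⁻¹(A ∫_{|z|<1}|z|⁻¹ + W)`:

* `quasiLipschitz_biotSavart2D_of_bounds` — the hypothesis of the ODE files, uniformly in `t`;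
  `norm_biotSavart2D_le_of_bounds` — `‖v(t, x)‖ ≤ M`;
* `hasDerivAt_evolutionMap_biotSavart2D` — **the particle trajectories
  `X(α, t; t₀) = φ(t, t₀, α) = ODE.evolutionMap v t₀ t α` exist for all times and solve
  `dX/dt = v(X, t)`**, and `evolutionMap_eq_of_hasDerivAt_biotSavart2D` — **they are unique**;
* `norm_evolutionMap_biotSavart2D_sub_le` — **(8.33)/(8.34)**:
  `|X(α¹,t) − X(α²,t)| ≤ e |α¹ − α²|^{exp(−L|t − t₀|)}` for `|α¹ − α²| ≤ exp(−exp L|t − t₀|)`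
  (forward and backward maps alike);
* `norm_evolutionMap_biotSavart2D_sub_evolutionMap_le` — **(8.36)**:
  `|X(α,t₁) − X(α,t₂)| ≤ M|t₁ − t₂|`.

v2 (same session) adds: `norm_biotSavart2D_le_of_bounds'` — the speed bound with the radial
integral evaluated, `‖v‖ ≤ A + (2π)⁻¹ W` (`∫_{|z|<1}|z|⁻¹ dz = 2π`);
`norm_evolutionMap_biotSavart2D_sub_evolutionMap_le_holder` — **(8.35)/(8.37)**, the time-Hölder
modulus `|X(α; t₁ → t₀) − X(α; t₂ → t₀)| ≤ e (M|t₁ − t₂|)^{exp(−L|t₀ − t₁|)}`; and the section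
`L1Continuous`: when **`t ↦ ω(·, t)` is continuous in `L¹`** (`∫|ω(t) − ω(t₀)| → 0`, as for the
weak solutions of Theorem 8.1 whose vorticity is transported by the Hölder flow) the joint
continuity hypothesis `hc` HOLDS (`continuous_uncurry_biotSavart2D`, file `BiotSavart2DContinuity`),
so the trajectory theorems are stated under `(hω, hA, hW, hL1)` alone:
`hasDerivAt_evolutionMap_biotSavart2D_of_tendsto`,
`norm_evolutionMap_biotSavart2D_sub_le_of_tendsto`,
`norm_evolutionMap_biotSavart2D_sub_evolutionMap_le_of_tendsto`.

Theorems only; no definitions, no named facts.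

HONEST FRAMING (cell `pub-fluidc`): typed textbook infrastructure for a low prior, high
value-of-information experiment on Tao's machine paradigm; NOT a claim that NS blows up.

## References

* [MajdaBertozziCUP2002] A. J. Majda, A. L. Bertozzi, Vorticity and Incompressible Flow, CUP 2002
  — §8.2.2 (8.21)–(8.22), (8.27) (held text pp. 273–275), §8.2.3 Lemma 8.1 (8.32), Lemma 8.2
  (8.33)–(8.36) (pp. 276–277), proofs (pp. 279–281), §8.2.4 first paragraph (p. 281).
-/

noncomputable section

open Set Function Filter MeasureTheory Metric
open scoped Topology

namespace Literature.Analysis.FluidPDE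


section Trajectories

variable {ω : ℝ → EuclideanSpace ℝ (Fin 2) → ℝ} {A W : ℝ}

/-- **(8.32) uniformly in time**: if `|ω(t,·)| ≤ A` and `‖ω(t,·)‖₁ ≤ W` for all `t`, the velocity
`v(t,·) = K₂ ∗ ω(t,·)` satisfies the quasi-Lipschitz hypothesis of `ODE/QuasiLipschitzTrajectories`
with `L = 5(A + W)`. [cite: MajdaBertozziCUP2002, §8.2.3 Lemma 8.1 (8.32) (held text p. 276)] -/
theorem quasiLipschitz_biotSavart2D_of_bounds (hω : ∀ t, Integrable (ω t))
    (hA : ∀ t y, |ω t y| ≤ A) (hW : ∀ t, ∫ y, |ω t y| ≤ W) (t : ℝ) (p q : EuclideanSpace ℝ (Fin 2))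
    (h0 : 0 < ‖p - q‖) (h1 : ‖p - q‖ < 1) :
    ‖biotSavart2D (ω t) p - biotSavart2D (ω t) q‖ ≤
      5 * (A + W) * ‖p - q‖ * (1 - Real.log ‖p - q‖) := by
  refine (norm_biotSavart2D_sub_le_quasiLipschitz (hω t) (hA t) h0 h1).trans ?_
  have hlog : 0 ≤ 1 - Real.log ‖p - q‖ := by
    have := Real.log_nonpos h0.le h1.le; linarith
  have hA0 : 0 ≤ A := (abs_nonneg _).trans (hA t 0)
  have h2 : 5 * (A + ∫ y, |ω t y|) ≤ 5 * (A + W) := by linarith [hW t]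
  exact mul_le_mul_of_nonneg_right (mul_le_mul_of_nonneg_right h2 h0.le) hlog

/-- **(8.27) uniformly in time**: `‖v(t, x)‖ ≤ M = (2π)⁻¹(A ∫_{|z|<1}|z|⁻¹ dz + W)`.
[cite: MajdaBertozziCUP2002, §8.2.2 (8.27) (held text p. 275)] -/
theorem norm_biotSavart2D_le_of_bounds (hω : ∀ t, Integrable (ω t)) (hA : ∀ t y, |ω t y| ≤ A)
    (hW : ∀ t, ∫ y, |ω t y| ≤ W) (t : ℝ) (x : EuclideanSpace ℝ (Fin 2)) :
    ‖biotSavart2D (ω t) x‖ ≤ (2 * Real.pi)⁻¹ *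
      (A * (∫ z, indicator (ball (0 : EuclideanSpace ℝ (Fin 2)) 1) (fun z => ‖z‖⁻¹) z) + W) := by
  refine (norm_biotSavart2D_le (hω t) (hA t) x).trans ?_
  gcongr
  exact hW t

/-- The constant `L = 5(A + W)` is nonnegative.
[cite: MajdaBertozziCUP2002, §8.2.3 Lemma 8.1 (8.32) (held text p. 276)] -/
private theorem hL0 (hA : ∀ t y, |ω t y| ≤ A) (hW : ∀ t, ∫ y, |ω t y| ≤ W) :
    0 ≤ 5 * (A + W) := by
  have hA0 : 0 ≤ A := (abs_nonneg _).trans (hA 0 0)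
  have hW0 : 0 ≤ W := (integral_nonneg fun _ => abs_nonneg _).trans (hW 0)
  positivity

variable (hω : ∀ t, Integrable (ω t)) (hA : ∀ t y, |ω t y| ≤ A) (hW : ∀ t, ∫ y, |ω t y| ≤ W)
  (hc : Continuous (uncurry fun t x => biotSavart2D (ω t) x))
include hω hA hW hc

/-- **The particle trajectories of `v = K₂ ∗ ω` exist for all times and solve `dX/dt = v(X, t)`**:
for every `t₀`, `α`, `t ↦ X(α; t₀, t) = φ(t, t₀, α)` has derivative `v(t, X)` at every `t ∈ ℝ`, with
`X(α; t₀, t₀) = α` (`ODE.evolutionMap_self`) — Peano existence + Osgood uniqueness for the bounded,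
continuous, quasi-Lipschitz field `v`.
[cite: MajdaBertozziCUP2002, §8.2.2 Prop. 8.2 (ii) and (8.30) (held text pp. 275–277); §8.2.4 first
paragraph (p. 281)] -/
theorem hasDerivAt_evolutionMap_biotSavart2D (t₀ : ℝ) (α : EuclideanSpace ℝ (Fin 2)) (t : ℝ) :
    HasDerivAt (fun r => ODE.evolutionMap (fun s x => biotSavart2D (ω s) x) t₀ r α)
      (biotSavart2D (ω t) (ODE.evolutionMap (fun s x => biotSavart2D (ω s) x) t₀ t α)) t :=
  ODE.hasDerivAt_evolutionMap_of_quasiLipschitz hc (norm_biotSavart2D_le_of_bounds hω hA hW)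
    (hL0 hA hW) (quasiLipschitz_biotSavart2D_of_bounds hω hA hW) t₀ α t

omit hc in
/-- **Uniqueness of the particle trajectories** ("the limit particle trajectory `Xᵗ(·)` is
unique"): every global solution of `γ' = v(t, γ)` is `t ↦ φ(t, t₀, γ t₀)`.
[cite: MajdaBertozziCUP2002, §8.2.4 first paragraph (held text p. 281)] -/
theorem evolutionMap_eq_of_hasDerivAt_biotSavart2D {γ : ℝ → EuclideanSpace ℝ (Fin 2)}
    (hγ : ∀ s, HasDerivAt γ (biotSavart2D (ω s) (γ s)) s) (t₀ t : ℝ) :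
    ODE.evolutionMap (fun s x => biotSavart2D (ω s) x) t₀ t (γ t₀) = γ t :=
  ODE.evolutionMap_eq_of_hasDerivAt_of_quasiLipschitz (hL0 hA hW)
    (quasiLipschitz_biotSavart2D_of_bounds hω hA hW) hγ t₀ t

/-- **Majda–Bertozzi Lemma 8.2, (8.33)/(8.34), for the trajectories of `v = K₂ ∗ ω`**: with
`L = 5(A + W)`, `‖φ(t,t₀,α) − φ(t,t₀,β)‖ ≤ e ‖α − β‖^{exp(−L|t − t₀|)}` whenever
`‖α − β‖ ≤ exp(−exp L|t − t₀|)` (forward `X(·,t) = φ(t,0,·)` and backward `X⁻ᵗ = φ(0,t,·)` alike).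
[cite: MajdaBertozziCUP2002, §8.2.3 Lemma 8.2 (8.33)–(8.34) (held text p. 277) and proof
(p. 281)] -/
theorem norm_evolutionMap_biotSavart2D_sub_le (t₀ t : ℝ) {α β : EuclideanSpace ℝ (Fin 2)}
    (hsmall : ‖α - β‖ ≤ Real.exp (-Real.exp (5 * (A + W) * |t - t₀|))) :
    ‖ODE.evolutionMap (fun s x => biotSavart2D (ω s) x) t₀ t α -
        ODE.evolutionMap (fun s x => biotSavart2D (ω s) x) t₀ t β‖ ≤
      Real.exp 1 * ‖α - β‖ ^ Real.exp (-(5 * (A + W)) * |t - t₀|) :=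
  ODE.norm_evolutionMap_sub_le_of_quasiLipschitz' hc (norm_biotSavart2D_le_of_bounds hω hA hW)
    (hL0 hA hW) (quasiLipschitz_biotSavart2D_of_bounds hω hA hW) t₀ t hsmall

/-- **Majda–Bertozzi Lemma 8.2, (8.36): bounded speed, Lipschitz in time**,
`‖φ(t₁,t₀,α) − φ(t₂,t₀,α)‖ ≤ M |t₁ − t₂|`, `M = (2π)⁻¹(A ∫_{|z|<1}|z|⁻¹ + W)`.
[cite: MajdaBertozziCUP2002, §8.2.3 Lemma 8.2 (8.36) (held text p. 277); §8.2.2 (8.27) (p. 275)] -/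
theorem norm_evolutionMap_biotSavart2D_sub_evolutionMap_le (t₀ t₁ t₂ : ℝ)
    (α : EuclideanSpace ℝ (Fin 2)) :
    ‖ODE.evolutionMap (fun s x => biotSavart2D (ω s) x) t₀ t₁ α -
        ODE.evolutionMap (fun s x => biotSavart2D (ω s) x) t₀ t₂ α‖ ≤
      (2 * Real.pi)⁻¹ *
          (A * (∫ z, indicator (ball (0 : EuclideanSpace ℝ (Fin 2)) 1) (fun z => ‖z‖⁻¹) z) + W) *
        |t₁ - t₂| :=
  ODE.norm_evolutionMap_sub_evolutionMap_le_of_norm_le hc (norm_biotSavart2D_le_of_bounds hω hA hW)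
    (hL0 hA hW) (quasiLipschitz_biotSavart2D_of_bounds hω hA hW) t₀ t₁ t₂ α

/-- **Majda–Bertozzi Lemma 8.2, (8.35)/(8.37): Hölder continuity in time** of the trajectories of
`v = K₂ ∗ ω`: with `M` the speed bound of (8.27) and `L = 5(A + W)`,
`‖φ(t₀; t₁, α) − φ(t₀; t₂, α)‖ ≤ e (M|t₁ − t₂|)^{exp(−L|t₀ − t₁|)}` whenever
`M|t₁ − t₂| ≤ exp(−exp L|t₀ − t₁|)` (group law, (8.36), then (8.33) — MB's display (8.37)).
[cite: MajdaBertozziCUP2002, §8.2.3 Lemma 8.2 (8.35) (held text p. 277) and proof, display (8.37)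
(p. 281)] -/
theorem norm_evolutionMap_biotSavart2D_sub_evolutionMap_le_holder (t₀ t₁ t₂ : ℝ)
    (α : EuclideanSpace ℝ (Fin 2))
    (hsmall : (2 * Real.pi)⁻¹ *
        (A * (∫ z, indicator (ball (0 : EuclideanSpace ℝ (Fin 2)) 1) (fun z => ‖z‖⁻¹) z) + W) *
        |t₁ - t₂| ≤ Real.exp (-Real.exp (5 * (A + W) * |t₀ - t₁|))) :
    ‖ODE.evolutionMap (fun s x => biotSavart2D (ω s) x) t₁ t₀ α -
        ODE.evolutionMap (fun s x => biotSavart2D (ω s) x) t₂ t₀ α‖ ≤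
      Real.exp 1 * ((2 * Real.pi)⁻¹ *
        (A * (∫ z, indicator (ball (0 : EuclideanSpace ℝ (Fin 2)) 1) (fun z => ‖z‖⁻¹) z) + W) *
          |t₁ - t₂|) ^ Real.exp (-(5 * (A + W)) * |t₀ - t₁|) :=
  ODE.norm_evolutionMap_sub_evolutionMap_le_of_quasiLipschitz' hc
    (norm_biotSavart2D_le_of_bounds hω hA hW) (hL0 hA hW)
    (quasiLipschitz_biotSavart2D_of_bounds hω hA hW) t₀ t₁ t₂ α hsmall

omit hc in
/-- **(8.27) with the radial integral evaluated**: `‖v(t, x)‖ ≤ A + (2π)⁻¹ W`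
(`(2π)⁻¹ ∫_{|z|<1}|z|⁻¹ dz = 1`; `norm_biotSavart2D_le_of_radius` at `R = 1`).
[cite: MajdaBertozziCUP2002, §8.2.3 Prop. 8.2 (i) (8.27) and its proof (held text p. 275)] -/
theorem norm_biotSavart2D_le_of_bounds' (t : ℝ) (x : EuclideanSpace ℝ (Fin 2)) :
    ‖biotSavart2D (ω t) x‖ ≤ A + (2 * Real.pi)⁻¹ * W := by
  have h := norm_biotSavart2D_le_of_radius (hω t) (hA t) one_pos x
  rw [mul_one, mul_one] at h
  refine h.trans ?_
  gcongr
  exact hW t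

end Trajectories

section L1Continuous

variable {ω : ℝ → EuclideanSpace ℝ (Fin 2) → ℝ} {A W : ℝ}
  (hω : ∀ t, Integrable (ω t)) (hA : ∀ t y, |ω t y| ≤ A) (hW : ∀ t, ∫ y, |ω t y| ≤ W)
  (hL1 : ∀ t₀, Tendsto (fun t => ∫ y, |ω t y - ω t₀ y|) (𝓝 t₀) (𝓝 0))
include hω hA hW hL1

/-- **The trajectories of a vorticity `ω ∈ L^∞ ∩ C(ℝ; L¹)`**: with `|ω| ≤ A`, `‖ω(t)‖₁ ≤ W` and
`t ↦ ω(·,t)` continuous in `L¹`, the velocity `v = K₂ ∗ ω(t)` is jointly continuous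
(`continuous_uncurry_biotSavart2D`), so for every `t₀`, `α` the curve `t ↦ φ(t, t₀, α)` solves
`dX/dt = v(X, t)` on all of `ℝ` with `X(t₀) = α`.
[cite: MajdaBertozziCUP2002, §8.2.2 Prop. 8.2 (ii) and (8.30) (held text pp. 275–277); §8.2.5
proof of Prop. 8.3, Step 3 (p. 288)] -/
theorem hasDerivAt_evolutionMap_biotSavart2D_of_tendsto (t₀ : ℝ) (α : EuclideanSpace ℝ (Fin 2))
    (t : ℝ) :
    HasDerivAt (fun r => ODE.evolutionMap (fun s x => biotSavart2D (ω s) x) t₀ r α)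
      (biotSavart2D (ω t) (ODE.evolutionMap (fun s x => biotSavart2D (ω s) x) t₀ t α)) t :=
  hasDerivAt_evolutionMap_biotSavart2D hω hA hW (continuous_uncurry_biotSavart2D hω hA hL1) t₀ α t

/-- **(8.33)/(8.34) for `ω ∈ L^∞ ∩ C(ℝ; L¹)`**:
`‖φ(t,t₀,α) − φ(t,t₀,β)‖ ≤ e‖α − β‖^{exp(−L|t−t₀|)}`, `L = 5(A + W)`, whenever
`‖α − β‖ ≤ exp(−exp L|t − t₀|)`.
[cite: MajdaBertozziCUP2002, §8.2.3 Lemma 8.2 (8.33)–(8.34) (held text p. 277) and proof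
(p. 281)] -/
theorem norm_evolutionMap_biotSavart2D_sub_le_of_tendsto (t₀ t : ℝ)
    {α β : EuclideanSpace ℝ (Fin 2)}
    (hsmall : ‖α - β‖ ≤ Real.exp (-Real.exp (5 * (A + W) * |t - t₀|))) :
    ‖ODE.evolutionMap (fun s x => biotSavart2D (ω s) x) t₀ t α -
        ODE.evolutionMap (fun s x => biotSavart2D (ω s) x) t₀ t β‖ ≤
      Real.exp 1 * ‖α - β‖ ^ Real.exp (-(5 * (A + W)) * |t - t₀|) :=
  norm_evolutionMap_biotSavart2D_sub_le hω hA hW (continuous_uncurry_biotSavart2D hω hA hL1) t₀ t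
    hsmall

/-- **(8.36) for `ω ∈ L^∞ ∩ C(ℝ; L¹)`**: `‖φ(t₁,t₀,α) − φ(t₂,t₀,α)‖ ≤ (A + (2π)⁻¹W) |t₁ − t₂|`
(speed bound with the radial integral evaluated).
[cite: MajdaBertozziCUP2002, §8.2.3 Lemma 8.2 (8.36) (held text p. 277); (8.27) (p. 275)] -/
theorem norm_evolutionMap_biotSavart2D_sub_evolutionMap_le_of_tendsto (t₀ t₁ t₂ : ℝ)
    (α : EuclideanSpace ℝ (Fin 2)) :
    ‖ODE.evolutionMap (fun s x => biotSavart2D (ω s) x) t₀ t₁ α -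
        ODE.evolutionMap (fun s x => biotSavart2D (ω s) x) t₀ t₂ α‖ ≤
      (A + (2 * Real.pi)⁻¹ * W) * |t₁ - t₂| := by
  have hA0 : 0 ≤ A := (abs_nonneg _).trans (hA 0 0)
  have hW0 : 0 ≤ W := (integral_nonneg fun _ => abs_nonneg _).trans (hW 0)
  have hL : (0 : ℝ) ≤ 5 * (A + W) := by positivity
  exact ODE.norm_evolutionMap_sub_evolutionMap_le_of_norm_le
    (continuous_uncurry_biotSavart2D hω hA hL1) (norm_biotSavart2D_le_of_bounds' hω hA hW) hL
    (quasiLipschitz_biotSavart2D_of_bounds hω hA hW) t₀ t₁ t₂ α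

end L1Continuous

end Literature.Analysis.FluidPDE

end
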